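import Summits.KontsevichZagierPeriods.KontsevichZagierPeriods.Theorems.HyperellipticRiemannRelation.Negative.SignPatterns
import Summits.KontsevichZagierPeriods.KontsevichZagierPeriods.Theorems.HyperellipticRiemannRelation.Negative.Witnesses

/-!
# `HyperellipticRiemannRelation` (stmt-KontsevichZagierPeriods-3522) — negative knowledge, part 3: non-vacuity and load-bearing hypotheses

Support file for the crux `UnfoldedStokes.HyperellipticRiemannRelation` (cdisprove seat, cycle 1;
work file `Cruxes/HyperellipticRiemannRelation/Disproof.lean`), over part 1 (`SignPatterns`:
admissible values are positive) and part 2 (`Witnesses`: admissible representations exist at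
`e = (0,1,2,3,5)`).

* `hypotheses_satisfiable` — the seven hypotheses of the crux are simultaneously satisfiable
  (non-vacuity), so by `hyperellipticRiemannRelation_of_exists` (part 1) the crux at
  `e = (0,1,2,3,5)` is ONE membership statement about the canonical triple;
* LOAD-BEARING HYPOTHESES: each of the seven hypotheses is necessary — the crux with that
  hypothesis deleted is FALSE (`hyperellipticRiemannRelation_false_without_*`): two admissible
  choices of different value cannot both give relations (soundness,
  `KZ.relations_le_ker_eval_holds`). For the six representation hypotheses the witnesses are the
  canonical box representation (value `W > 0`, part 1) against the empty-domain / zero-integrand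
  representation (value `0`); for `StrictMono e` the witness is the NON-MONOTONE configuration
  `e = (0,1,2,5,3)` (same quintic!), for which the boxes of `r₁₄`, `r₃₄` are empty while
  `J₁ × J₂ = (0,1) × (1,2)` keeps its positive value `W₁₂`: any proof must use the ORDER of the
  roots, and specifically `e 3 < e 4`.
* RIGIDITY OF THE SIGN PATTERN (§4): given the crux pattern `(+,−,+)`, the patterns `(+,−,−)`
  and `(+,+,−)` are not relations (`pattern_pmm_not_mem_relations`,
  `pattern_ppm_not_mem_relations`); with part 1's `all_plus_not_mem_relations` this exhausts the
  sign classes: the coefficient vector `(1,−1,1)` is rigid.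
Each `¬ (…)` below is the crux VERBATIM with exactly one hypothesis removed. No definitions are
introduced. [Kontsevich–Zagier 2001, §1.2] [folklore]
-/

noncomputable section

open Set MeasureTheory
open Literature.NumberTheory.Transcendental Literature.ModelTheory.ExponentialFields
open Summit.KontsevichZagierPeriods.KontsevichZagierPeriods.Theses.UnfoldedStokes
  (HyperellipticRiemannRelation)

namespace Summit.KontsevichZagierPeriods.UnfoldedStokes.HyperellipticRiemannRelationNegative

/-! ### §1 The crux's boxes at `e = (0,1,2,3,5)` and at the non-monotone `e = (0,1,2,5,3)` -/

/-- The box of `r₁₂` at `e = (0,1,2,3,5)` in coordinates. [folklore] -/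
theorem box₁₂_e₀ : {x : Fin 2 → ℝ | ((![0, 1, 2, 3, 5] : Fin 5 → ℚ) 0 : ℝ) < x 0 ∧ x 0 < ((![0, 1, 2, 3, 5] : Fin 5 → ℚ) 1 : ℝ) ∧ ((![0, 1, 2, 3, 5] : Fin 5 → ℚ) 1 : ℝ) < x 1 ∧ x 1 < ((![0, 1, 2, 3, 5] : Fin 5 → ℚ) 2 : ℝ)} =
    {x | (0:ℝ) < x 0 ∧ x 0 < 1 ∧ (1:ℝ) < x 1 ∧ x 1 < 2} := by
  ext x; simp

/-- The box of `r₁₄` at `e = (0,1,2,3,5)` in coordinates. [folklore] -/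
theorem box₁₄_e₀ : {x : Fin 2 → ℝ | ((![0, 1, 2, 3, 5] : Fin 5 → ℚ) 0 : ℝ) < x 0 ∧ x 0 < ((![0, 1, 2, 3, 5] : Fin 5 → ℚ) 1 : ℝ) ∧ ((![0, 1, 2, 3, 5] : Fin 5 → ℚ) 3 : ℝ) < x 1 ∧ x 1 < ((![0, 1, 2, 3, 5] : Fin 5 → ℚ) 4 : ℝ)} =
    {x | (0:ℝ) < x 0 ∧ x 0 < 1 ∧ (3:ℝ) < x 1 ∧ x 1 < 5} := by
  ext x; simp

/-- The box of `r₃₄` at `e = (0,1,2,3,5)` in coordinates. [folklore] -/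
theorem box₃₄_e₀ : {x : Fin 2 → ℝ | ((![0, 1, 2, 3, 5] : Fin 5 → ℚ) 2 : ℝ) < x 0 ∧ x 0 < ((![0, 1, 2, 3, 5] : Fin 5 → ℚ) 3 : ℝ) ∧ ((![0, 1, 2, 3, 5] : Fin 5 → ℚ) 3 : ℝ) < x 1 ∧ x 1 < ((![0, 1, 2, 3, 5] : Fin 5 → ℚ) 4 : ℝ)} =
    {x | (2:ℝ) < x 0 ∧ x 0 < 3 ∧ (3:ℝ) < x 1 ∧ x 1 < 5} := by
  ext x; simp

/-- The box of `r₁₂` at the non-monotone `e = (0,1,2,5,3)` in coordinates. [folklore] -/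
theorem box₁₂_e₁ : {x : Fin 2 → ℝ | ((![0, 1, 2, 5, 3] : Fin 5 → ℚ) 0 : ℝ) < x 0 ∧ x 0 < ((![0, 1, 2, 5, 3] : Fin 5 → ℚ) 1 : ℝ) ∧ ((![0, 1, 2, 5, 3] : Fin 5 → ℚ) 1 : ℝ) < x 1 ∧ x 1 < ((![0, 1, 2, 5, 3] : Fin 5 → ℚ) 2 : ℝ)} =
    {x | (0:ℝ) < x 0 ∧ x 0 < 1 ∧ (1:ℝ) < x 1 ∧ x 1 < 2} := by
  ext x; simp

/-- The box of `r₁₄` at the non-monotone `e = (0,1,2,5,3)` in coordinates (EMPTY). [folklore] -/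
theorem box₁₄_e₁ : {x : Fin 2 → ℝ | ((![0, 1, 2, 5, 3] : Fin 5 → ℚ) 0 : ℝ) < x 0 ∧ x 0 < ((![0, 1, 2, 5, 3] : Fin 5 → ℚ) 1 : ℝ) ∧ ((![0, 1, 2, 5, 3] : Fin 5 → ℚ) 3 : ℝ) < x 1 ∧ x 1 < ((![0, 1, 2, 5, 3] : Fin 5 → ℚ) 4 : ℝ)} =
    {x | (0:ℝ) < x 0 ∧ x 0 < 1 ∧ (5:ℝ) < x 1 ∧ x 1 < 3} := by
  ext x; simp

/-- The box of `r₃₄` at the non-monotone `e = (0,1,2,5,3)` in coordinates (EMPTY). [folklore] -/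
theorem box₃₄_e₁ : {x : Fin 2 → ℝ | ((![0, 1, 2, 5, 3] : Fin 5 → ℚ) 2 : ℝ) < x 0 ∧ x 0 < ((![0, 1, 2, 5, 3] : Fin 5 → ℚ) 3 : ℝ) ∧ ((![0, 1, 2, 5, 3] : Fin 5 → ℚ) 3 : ℝ) < x 1 ∧ x 1 < ((![0, 1, 2, 5, 3] : Fin 5 → ℚ) 4 : ℝ)} =
    {x | (2:ℝ) < x 0 ∧ x 0 < 5 ∧ (5:ℝ) < x 1 ∧ x 1 < 3} := by
  ext x; simp

/-- The non-monotone configuration has the SAME quintic: `∏ (t − e i)` is symmetric. [folklore] -/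
theorem prod_e₁ (t : ℝ) :
    ∏ i : Fin 5, (t - ((![0, 1, 2, 5, 3] : Fin 5 → ℚ) i : ℝ)) = t * (t - 1) * (t - 2) * (t - 3) * (t - 5) := by
  simp [Fin.prod_univ_five]; ring

/-- Hence the crux integrand at `e = (0,1,2,5,3)` is the one at `e = (0,1,2,3,5)`. [folklore] -/
theorem integrand_e₁ (x : Fin 2 → ℝ) :
    (x 1 - x 0) / Real.sqrt (|∏ i : Fin 5, (x 0 - ((![0, 1, 2, 5, 3] : Fin 5 → ℚ) i : ℝ))| *
      |∏ i : Fin 5, (x 1 - ((![0, 1, 2, 5, 3] : Fin 5 → ℚ) i : ℝ))|) =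
    (x 1 - x 0) / Real.sqrt (|∏ i : Fin 5, (x 0 - ((![0, 1, 2, 3, 5] : Fin 5 → ℚ) i : ℝ))| *
      |∏ i : Fin 5, (x 1 - ((![0, 1, 2, 3, 5] : Fin 5 → ℚ) i : ℝ))|) := by
  rw [prod_e₁, prod_e₁, prod_e₀, prod_e₀]

/-! ### §2 Non-vacuity -/

/-- **Non-vacuity.** The hypotheses of `HyperellipticRiemannRelation` are simultaneously
satisfiable: at `e = (0,1,2,3,5)` the canonical box representations of part 2 are admissible.
[cite: KontsevichZagier2001, §1.1] -/
theorem hypotheses_satisfiable : ∃ e : Fin 5 → ℚ, StrictMono e ∧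
    ∃ r₁₂ r₁₄ r₃₄ : KZ.IntegralRep 2,
      r₁₂.domain = {x | (e 0 : ℝ) < x 0 ∧ x 0 < (e 1 : ℝ) ∧ (e 1 : ℝ) < x 1 ∧ x 1 < (e 2 : ℝ)} ∧
      r₁₄.domain = {x | (e 0 : ℝ) < x 0 ∧ x 0 < (e 1 : ℝ) ∧ (e 3 : ℝ) < x 1 ∧ x 1 < (e 4 : ℝ)} ∧
      r₃₄.domain = {x | (e 2 : ℝ) < x 0 ∧ x 0 < (e 3 : ℝ) ∧ (e 3 : ℝ) < x 1 ∧ x 1 < (e 4 : ℝ)} ∧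
      EqOn r₁₂.integrand (fun x => (x 1 - x 0) / Real.sqrt (|∏ i : Fin 5, (x 0 - (e i : ℝ))| * |∏ i : Fin 5, (x 1 - (e i : ℝ))|)) r₁₂.domain ∧
      EqOn r₁₄.integrand (fun x => (x 1 - x 0) / Real.sqrt (|∏ i : Fin 5, (x 0 - (e i : ℝ))| * |∏ i : Fin 5, (x 1 - (e i : ℝ))|)) r₁₄.domain ∧
      EqOn r₃₄.integrand (fun x => (x 1 - x 0) / Real.sqrt (|∏ i : Fin 5, (x 0 - (e i : ℝ))| * |∏ i : Fin 5, (x 1 - (e i : ℝ))|)) r₃₄.domain := by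
  obtain ⟨r₁₂, hd₁₂, hi₁₂⟩ := exists_rep₁₂
  obtain ⟨r₁₄, hd₁₄, hi₁₄⟩ := exists_rep₁₄
  obtain ⟨r₃₄, hd₃₄, hi₃₄⟩ := exists_rep₃₄
  exact ⟨_, strictMono_e₀, r₁₂, r₁₄, r₃₄, hd₁₂.trans box₁₂_e₀.symm, hd₁₄.trans box₁₄_e₀.symm,
    hd₃₄.trans box₃₄_e₀.symm, fun x _ => congrFun hi₁₂ x, fun x _ => congrFun hi₁₄ x,
    fun x _ => congrFun hi₃₄ x⟩

/-- The crux at `e = (0,1,2,3,5)` applied to the canonical triple: the values satisfy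
`W₁₄ = W₁₂ + W₃₄`, all three positive (parts 1–2). [cite: KontsevichZagier2001, §1.2] -/
theorem canonical_values_of_hyperellipticRiemannRelation (h : HyperellipticRiemannRelation) :
    ∃ r₁₂ r₁₄ r₃₄ : KZ.IntegralRep 2,
      r₁₂.domain = {x | (0:ℝ) < x 0 ∧ x 0 < 1 ∧ (1:ℝ) < x 1 ∧ x 1 < 2} ∧
      r₁₄.domain = {x | (0:ℝ) < x 0 ∧ x 0 < 1 ∧ (3:ℝ) < x 1 ∧ x 1 < 5} ∧
      r₃₄.domain = {x | (2:ℝ) < x 0 ∧ x 0 < 3 ∧ (3:ℝ) < x 1 ∧ x 1 < 5} ∧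
      r₁₂.integrand = (fun x : Fin 2 → ℝ => (x 1 - x 0) /
      Real.sqrt (|∏ i : Fin 5, (x 0 - ((![0, 1, 2, 3, 5] : Fin 5 → ℚ) i : ℝ))| *
        |∏ i : Fin 5, (x 1 - ((![0, 1, 2, 3, 5] : Fin 5 → ℚ) i : ℝ))|)) ∧ r₁₄.integrand = r₁₂.integrand ∧ r₃₄.integrand = r₁₂.integrand ∧
      0 < r₁₂.value ∧ 0 < r₃₄.value ∧ r₁₄.value = r₁₂.value + r₃₄.value := by
  obtain ⟨r₁₂, hd₁₂, hi₁₂⟩ := exists_rep₁₂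
  obtain ⟨r₁₄, hd₁₄, hi₁₄⟩ := exists_rep₁₄
  obtain ⟨r₃₄, hd₃₄, hi₃₄⟩ := exists_rep₃₄
  have hm := h _ strictMono_e₀ r₁₂ r₁₄ r₃₄ (hd₁₂.trans box₁₂_e₀.symm) (hd₁₄.trans box₁₄_e₀.symm)
    (hd₃₄.trans box₃₄_e₀.symm) (fun x _ => congrFun hi₁₂ x) (fun x _ => congrFun hi₁₄ x)
    (fun x _ => congrFun hi₃₄ x)
  exact ⟨r₁₂, r₁₄, r₃₄, hd₁₂, hd₁₄, hd₃₄, hi₁₂, hi₁₄.trans hi₁₂.symm, hi₃₄.trans hi₁₂.symm,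
    value_pos₁₂ strictMono_e₀ r₁₂ (hd₁₂.trans box₁₂_e₀.symm) (fun x _ => congrFun hi₁₂ x),
    value_pos₃₄ strictMono_e₀ r₃₄ (hd₃₄.trans box₃₄_e₀.symm) (fun x _ => congrFun hi₃₄ x),
    value_eq_of_mem_relations hm⟩

/-! ### §3 Load-bearing hypotheses: each of the seven is necessary

Scheme: if hypothesis `H` is deleted, two admissible instances with DIFFERENT values of the
combination exist; were both combinations relations, their difference would be a relation of
non-zero value, contradicting soundness. -/

/-- Two admissible first slots with different values cannot both give relations. [folklore] -/
theorem not_both₁ {b c : KZ.FormalRep} {s s' : KZ.IntegralRep 2} (hv : s.value ≠ s'.value)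
    (h : KZ.of s - b + c ∈ KZ.relations) (h' : KZ.of s' - b + c ∈ KZ.relations) : False := by
  have hd := KZ.relations.sub_mem h h'
  have : KZ.of s - b + c - (KZ.of s' - b + c) = KZ.of s - KZ.of s' := by abel
  rw [this] at hd
  exact sub_not_mem_relations_of_value_ne hv hd

/-- Two admissible second slots with different values cannot both give relations. [folklore] -/
theorem not_both₂ {a c : KZ.FormalRep} {s s' : KZ.IntegralRep 2} (hv : s.value ≠ s'.value)
    (h : a - KZ.of s + c ∈ KZ.relations) (h' : a - KZ.of s' + c ∈ KZ.relations) : False := by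
  have hd := KZ.relations.sub_mem h' h
  have : a - KZ.of s' + c - (a - KZ.of s + c) = KZ.of s - KZ.of s' := by abel
  rw [this] at hd
  exact sub_not_mem_relations_of_value_ne hv hd

/-- Two admissible third slots with different values cannot both give relations. [folklore] -/
theorem not_both₃ {a b : KZ.FormalRep} {s s' : KZ.IntegralRep 2} (hv : s.value ≠ s'.value)
    (h : a - b + KZ.of s ∈ KZ.relations) (h' : a - b + KZ.of s' ∈ KZ.relations) : False := by
  have hd := KZ.relations.sub_mem h h'
  have : a - b + KZ.of s - (a - b + KZ.of s') = KZ.of s - KZ.of s' := by abel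
  rw [this] at hd
  exact sub_not_mem_relations_of_value_ne hv hd

/-- **Any proof must use `StrictMono e`** (indeed `e 3 < e 4`): the crux with the monotonicity
hypothesis deleted is false. Witness: the non-monotone `e = (0,1,2,5,3)` — same quintic
`t(t−1)(t−2)(t−3)(t−5)` — for which the boxes of `r₁₄` (`x 1 ∈ (5,3)`) and `r₃₄`
(`x 0 ∈ (2,5), x 1 ∈ (5,3)`) are EMPTY (zero representations, value `0`) while `r₁₂` is the
canonical box `(0,1) × (1,2)` of value `W₁₂ > 0`; the combination has value `W₁₂ ≠ 0`.
[folklore] -/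
theorem hyperellipticRiemannRelation_false_without_StrictMono :
    ¬ (∀ (e : Fin 5 → ℚ), ∀ (r₁₂ r₁₄ r₃₄ : Literature.NumberTheory.Transcendental.KZ.IntegralRep 2),
      r₁₂.domain = {x | (e 0 : ℝ) < x 0 ∧ x 0 < (e 1 : ℝ) ∧ (e 1 : ℝ) < x 1 ∧ x 1 < (e 2 : ℝ)} →
      r₁₄.domain = {x | (e 0 : ℝ) < x 0 ∧ x 0 < (e 1 : ℝ) ∧ (e 3 : ℝ) < x 1 ∧ x 1 < (e 4 : ℝ)} →
      r₃₄.domain = {x | (e 2 : ℝ) < x 0 ∧ x 0 < (e 3 : ℝ) ∧ (e 3 : ℝ) < x 1 ∧ x 1 < (e 4 : ℝ)} →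
      Set.EqOn r₁₂.integrand (fun x => (x 1 - x 0) / Real.sqrt (|∏ i : Fin 5, (x 0 - (e i : ℝ))| * |∏
      i : Fin 5, (x 1 - (e i : ℝ))|)) r₁₂.domain → Set.EqOn r₁₄.integrand (fun x => (x 1 - x 0) /
      Real.sqrt (|∏ i : Fin 5, (x 0 - (e i : ℝ))| * |∏ i : Fin 5, (x 1 - (e i : ℝ))|)) r₁₄.domain →
      Set.EqOn r₃₄.integrand (fun x => (x 1 - x 0) / Real.sqrt (|∏ i : Fin 5, (x 0 - (e i : ℝ))| * |∏
      i : Fin 5, (x 1 - (e i : ℝ))|)) r₃₄.domain → Literature.NumberTheory.Transcendental.KZ.of r₁₂ -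
      Literature.NumberTheory.Transcendental.KZ.of r₁₄ + Literature.NumberTheory.Transcendental.KZ.of
      r₃₄ ∈ Literature.NumberTheory.Transcendental.KZ.relations) := by
  intro H
  obtain ⟨r₁₂, hd₁₂, hi₁₂⟩ := exists_rep₁₂
  have hσ₁₄ : IsSemialgebraic ℚ {x : Fin 2 → ℝ | (0:ℝ) < x 0 ∧ x 0 < 1 ∧ (5:ℝ) < x 1 ∧ x 1 < 3} := by
    simpa using isSemialgebraic_box 0 1 5 3
  have hσ₃₄ : IsSemialgebraic ℚ {x : Fin 2 → ℝ | (2:ℝ) < x 0 ∧ x 0 < 5 ∧ (5:ℝ) < x 1 ∧ x 1 < 3} := by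
    simpa using isSemialgebraic_box 2 5 5 3
  obtain ⟨z₁₄, hz₁₄, hzi₁₄, hzv₁₄⟩ := exists_zeroRep₂ hσ₁₄
  obtain ⟨z₃₄, hz₃₄, hzi₃₄, hzv₃₄⟩ := exists_zeroRep₂ hσ₃₄
  have h := H (![0, 1, 2, 5, 3]) r₁₂ z₁₄ z₃₄ (hd₁₂.trans box₁₂_e₁.symm) (hz₁₄.trans box₁₄_e₁.symm)
    (hz₃₄.trans box₃₄_e₁.symm)
    (fun x _ => (congrFun hi₁₂ x).trans (integrand_e₁ x).symm)
    (fun x hx => by exfalso; rw [hz₁₄] at hx; linarith [hx.2.2.1, hx.2.2.2])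
    (fun x hx => by exfalso; rw [hz₃₄] at hx; linarith [hx.2.2.1, hx.2.2.2])
  have hv := (AddMonoidHom.mem_ker).1 (KZ.relations_le_ker_eval_holds h)
  rw [eval_combination, hzv₁₄, hzv₃₄] at hv
  have hpos := value_pos₁₂ strictMono_e₀ r₁₂ (hd₁₂.trans box₁₂_e₀.symm) (fun x _ => congrFun hi₁₂ x)
  linarith

/-- **Any proof must use the DOMAIN hypothesis on `r₁₂`**: the crux with it deleted is false (witnesses: canonical `[(0,1)×(1,2), G]` of value `W₁₂ > 0` vs the empty-domain representation of value `0`). [folklore] -/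
theorem hyperellipticRiemannRelation_false_without_domain₁₂ :
    ¬ (∀ (e : Fin 5 → ℚ), StrictMono e → ∀ (r₁₂ r₁₄ r₃₄ :
      Literature.NumberTheory.Transcendental.KZ.IntegralRep 2), r₁₄.domain = {x | (e 0 : ℝ) < x 0 ∧ x
      0 < (e 1 : ℝ) ∧ (e 3 : ℝ) < x 1 ∧ x 1 < (e 4 : ℝ)} → r₃₄.domain = {x | (e 2 : ℝ) < x 0 ∧ x 0 <
      (e 3 : ℝ) ∧ (e 3 : ℝ) < x 1 ∧ x 1 < (e 4 : ℝ)} → Set.EqOn r₁₂.integrand (fun x => (x 1 - x 0) /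
      Real.sqrt (|∏ i : Fin 5, (x 0 - (e i : ℝ))| * |∏ i : Fin 5, (x 1 - (e i : ℝ))|)) r₁₂.domain →
      Set.EqOn r₁₄.integrand (fun x => (x 1 - x 0) / Real.sqrt (|∏ i : Fin 5, (x 0 - (e i : ℝ))| * |∏
      i : Fin 5, (x 1 - (e i : ℝ))|)) r₁₄.domain → Set.EqOn r₃₄.integrand (fun x => (x 1 - x 0) /
      Real.sqrt (|∏ i : Fin 5, (x 0 - (e i : ℝ))| * |∏ i : Fin 5, (x 1 - (e i : ℝ))|)) r₃₄.domain →
      Literature.NumberTheory.Transcendental.KZ.of r₁₂ - Literature.NumberTheory.Transcendental.KZ.of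
      r₁₄ + Literature.NumberTheory.Transcendental.KZ.of r₃₄ ∈
      Literature.NumberTheory.Transcendental.KZ.relations) := by
  intro H
  obtain ⟨r₁₂, hd₁₂, hi₁₂⟩ := exists_rep₁₂
  obtain ⟨r₁₄, hd₁₄, hi₁₄⟩ := exists_rep₁₄
  obtain ⟨r₃₄, hd₃₄, hi₃₄⟩ := exists_rep₃₄
  obtain ⟨s, -, hsi, hsv⟩ := exists_emptyRep₂
  have h := H _ strictMono_e₀ r₁₂ r₁₄ r₃₄ (hd₁₄.trans box₁₄_e₀.symm) (hd₃₄.trans box₃₄_e₀.symm) (fun x _ => congrFun hi₁₂ x) (fun x _ => congrFun hi₁₄ x) (fun x _ => congrFun hi₃₄ x)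
  have h' := H _ strictMono_e₀ s r₁₄ r₃₄ (hd₁₄.trans box₁₄_e₀.symm) (hd₃₄.trans box₃₄_e₀.symm) (fun x _ => congrFun hsi x) (fun x _ => congrFun hi₁₄ x) (fun x _ => congrFun hi₃₄ x)
  exact not_both₁ (by rw [hsv]; exact (value_pos₁₂ strictMono_e₀ r₁₂ (hd₁₂.trans box₁₂_e₀.symm) (fun x _ => congrFun hi₁₂ x)).ne') h h'

/-- **Any proof must use the INTEGRAND hypothesis on `r₁₂`**: the crux with it deleted is false (witnesses: canonical vs the zero integrand on `(0,1)×(1,2)`). [folklore] -/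
theorem hyperellipticRiemannRelation_false_without_integrand₁₂ :
    ¬ (∀ (e : Fin 5 → ℚ), StrictMono e → ∀ (r₁₂ r₁₄ r₃₄ :
      Literature.NumberTheory.Transcendental.KZ.IntegralRep 2), r₁₂.domain = {x | (e 0 : ℝ) < x 0 ∧ x
      0 < (e 1 : ℝ) ∧ (e 1 : ℝ) < x 1 ∧ x 1 < (e 2 : ℝ)} → r₁₄.domain = {x | (e 0 : ℝ) < x 0 ∧ x 0 <
      (e 1 : ℝ) ∧ (e 3 : ℝ) < x 1 ∧ x 1 < (e 4 : ℝ)} → r₃₄.domain = {x | (e 2 : ℝ) < x 0 ∧ x 0 < (e 3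
      : ℝ) ∧ (e 3 : ℝ) < x 1 ∧ x 1 < (e 4 : ℝ)} → Set.EqOn r₁₄.integrand (fun x => (x 1 - x 0) /
      Real.sqrt (|∏ i : Fin 5, (x 0 - (e i : ℝ))| * |∏ i : Fin 5, (x 1 - (e i : ℝ))|)) r₁₄.domain →
      Set.EqOn r₃₄.integrand (fun x => (x 1 - x 0) / Real.sqrt (|∏ i : Fin 5, (x 0 - (e i : ℝ))| * |∏
      i : Fin 5, (x 1 - (e i : ℝ))|)) r₃₄.domain → Literature.NumberTheory.Transcendental.KZ.of r₁₂ -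
      Literature.NumberTheory.Transcendental.KZ.of r₁₄ + Literature.NumberTheory.Transcendental.KZ.of
      r₃₄ ∈ Literature.NumberTheory.Transcendental.KZ.relations) := by
  intro H
  obtain ⟨r₁₂, hd₁₂, hi₁₂⟩ := exists_rep₁₂
  obtain ⟨r₁₄, hd₁₄, hi₁₄⟩ := exists_rep₁₄
  obtain ⟨r₃₄, hd₃₄, hi₃₄⟩ := exists_rep₃₄
  have hσ : IsSemialgebraic ℚ {x : Fin 2 → ℝ | (0:ℝ) < x 0 ∧ x 0 < 1 ∧ (1:ℝ) < x 1 ∧ x 1 < 2} := by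
    simpa using isSemialgebraic_box 0 1 1 2
  obtain ⟨s, hsd, hsi, hsv⟩ := exists_zeroRep₂ hσ
  have h := H _ strictMono_e₀ r₁₂ r₁₄ r₃₄ (hd₁₂.trans box₁₂_e₀.symm) (hd₁₄.trans box₁₄_e₀.symm) (hd₃₄.trans box₃₄_e₀.symm) (fun x _ => congrFun hi₁₄ x) (fun x _ => congrFun hi₃₄ x)
  have h' := H _ strictMono_e₀ s r₁₄ r₃₄ (hsd.trans box₁₂_e₀.symm) (hd₁₄.trans box₁₄_e₀.symm) (hd₃₄.trans box₃₄_e₀.symm) (fun x _ => congrFun hi₁₄ x) (fun x _ => congrFun hi₃₄ x)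
  exact not_both₁ (by rw [hsv]; exact (value_pos₁₂ strictMono_e₀ r₁₂ (hd₁₂.trans box₁₂_e₀.symm) (fun x _ => congrFun hi₁₂ x)).ne') h h'

/-- **Any proof must use the DOMAIN hypothesis on `r₁₄`**: the crux with it deleted is false (witnesses: canonical `[(0,1)×(3,5), G]` of value `W₁₄ > 0` vs the empty-domain representation). [folklore] -/
theorem hyperellipticRiemannRelation_false_without_domain₁₄ :
    ¬ (∀ (e : Fin 5 → ℚ), StrictMono e → ∀ (r₁₂ r₁₄ r₃₄ :
      Literature.NumberTheory.Transcendental.KZ.IntegralRep 2), r₁₂.domain = {x | (e 0 : ℝ) < x 0 ∧ x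
      0 < (e 1 : ℝ) ∧ (e 1 : ℝ) < x 1 ∧ x 1 < (e 2 : ℝ)} → r₃₄.domain = {x | (e 2 : ℝ) < x 0 ∧ x 0 <
      (e 3 : ℝ) ∧ (e 3 : ℝ) < x 1 ∧ x 1 < (e 4 : ℝ)} → Set.EqOn r₁₂.integrand (fun x => (x 1 - x 0) /
      Real.sqrt (|∏ i : Fin 5, (x 0 - (e i : ℝ))| * |∏ i : Fin 5, (x 1 - (e i : ℝ))|)) r₁₂.domain →
      Set.EqOn r₁₄.integrand (fun x => (x 1 - x 0) / Real.sqrt (|∏ i : Fin 5, (x 0 - (e i : ℝ))| * |∏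
      i : Fin 5, (x 1 - (e i : ℝ))|)) r₁₄.domain → Set.EqOn r₃₄.integrand (fun x => (x 1 - x 0) /
      Real.sqrt (|∏ i : Fin 5, (x 0 - (e i : ℝ))| * |∏ i : Fin 5, (x 1 - (e i : ℝ))|)) r₃₄.domain →
      Literature.NumberTheory.Transcendental.KZ.of r₁₂ - Literature.NumberTheory.Transcendental.KZ.of
      r₁₄ + Literature.NumberTheory.Transcendental.KZ.of r₃₄ ∈
      Literature.NumberTheory.Transcendental.KZ.relations) := by
  intro H
  obtain ⟨r₁₂, hd₁₂, hi₁₂⟩ := exists_rep₁₂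
  obtain ⟨r₁₄, hd₁₄, hi₁₄⟩ := exists_rep₁₄
  obtain ⟨r₃₄, hd₃₄, hi₃₄⟩ := exists_rep₃₄
  obtain ⟨s, -, hsi, hsv⟩ := exists_emptyRep₂
  have h := H _ strictMono_e₀ r₁₂ r₁₄ r₃₄ (hd₁₂.trans box₁₂_e₀.symm) (hd₃₄.trans box₃₄_e₀.symm) (fun x _ => congrFun hi₁₂ x) (fun x _ => congrFun hi₁₄ x) (fun x _ => congrFun hi₃₄ x)
  have h' := H _ strictMono_e₀ r₁₂ s r₃₄ (hd₁₂.trans box₁₂_e₀.symm) (hd₃₄.trans box₃₄_e₀.symm) (fun x _ => congrFun hi₁₂ x) (fun x _ => congrFun hsi x) (fun x _ => congrFun hi₃₄ x)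
  exact not_both₂ (by rw [hsv]; exact (value_pos₁₄ strictMono_e₀ r₁₄ (hd₁₄.trans box₁₄_e₀.symm) (fun x _ => congrFun hi₁₄ x)).ne') h h'

/-- **Any proof must use the INTEGRAND hypothesis on `r₁₄`**: the crux with it deleted is false (witnesses: canonical vs the zero integrand on `(0,1)×(3,5)`). [folklore] -/
theorem hyperellipticRiemannRelation_false_without_integrand₁₄ :
    ¬ (∀ (e : Fin 5 → ℚ), StrictMono e → ∀ (r₁₂ r₁₄ r₃₄ :
      Literature.NumberTheory.Transcendental.KZ.IntegralRep 2), r₁₂.domain = {x | (e 0 : ℝ) < x 0 ∧ x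
      0 < (e 1 : ℝ) ∧ (e 1 : ℝ) < x 1 ∧ x 1 < (e 2 : ℝ)} → r₁₄.domain = {x | (e 0 : ℝ) < x 0 ∧ x 0 <
      (e 1 : ℝ) ∧ (e 3 : ℝ) < x 1 ∧ x 1 < (e 4 : ℝ)} → r₃₄.domain = {x | (e 2 : ℝ) < x 0 ∧ x 0 < (e 3
      : ℝ) ∧ (e 3 : ℝ) < x 1 ∧ x 1 < (e 4 : ℝ)} → Set.EqOn r₁₂.integrand (fun x => (x 1 - x 0) /
      Real.sqrt (|∏ i : Fin 5, (x 0 - (e i : ℝ))| * |∏ i : Fin 5, (x 1 - (e i : ℝ))|)) r₁₂.domain →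
      Set.EqOn r₃₄.integrand (fun x => (x 1 - x 0) / Real.sqrt (|∏ i : Fin 5, (x 0 - (e i : ℝ))| * |∏
      i : Fin 5, (x 1 - (e i : ℝ))|)) r₃₄.domain → Literature.NumberTheory.Transcendental.KZ.of r₁₂ -
      Literature.NumberTheory.Transcendental.KZ.of r₁₄ + Literature.NumberTheory.Transcendental.KZ.of
      r₃₄ ∈ Literature.NumberTheory.Transcendental.KZ.relations) := by
  intro H
  obtain ⟨r₁₂, hd₁₂, hi₁₂⟩ := exists_rep₁₂
  obtain ⟨r₁₄, hd₁₄, hi₁₄⟩ := exists_rep₁₄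
  obtain ⟨r₃₄, hd₃₄, hi₃₄⟩ := exists_rep₃₄
  have hσ : IsSemialgebraic ℚ {x : Fin 2 → ℝ | (0:ℝ) < x 0 ∧ x 0 < 1 ∧ (3:ℝ) < x 1 ∧ x 1 < 5} := by
    simpa using isSemialgebraic_box 0 1 3 5
  obtain ⟨s, hsd, hsi, hsv⟩ := exists_zeroRep₂ hσ
  have h := H _ strictMono_e₀ r₁₂ r₁₄ r₃₄ (hd₁₂.trans box₁₂_e₀.symm) (hd₁₄.trans box₁₄_e₀.symm) (hd₃₄.trans box₃₄_e₀.symm) (fun x _ => congrFun hi₁₂ x) (fun x _ => congrFun hi₃₄ x)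
  have h' := H _ strictMono_e₀ r₁₂ s r₃₄ (hd₁₂.trans box₁₂_e₀.symm) (hsd.trans box₁₄_e₀.symm) (hd₃₄.trans box₃₄_e₀.symm) (fun x _ => congrFun hi₁₂ x) (fun x _ => congrFun hi₃₄ x)
  exact not_both₂ (by rw [hsv]; exact (value_pos₁₄ strictMono_e₀ r₁₄ (hd₁₄.trans box₁₄_e₀.symm) (fun x _ => congrFun hi₁₄ x)).ne') h h'

/-- **Any proof must use the DOMAIN hypothesis on `r₃₄`**: the crux with it deleted is false (witnesses: canonical `[(2,3)×(3,5), G]` of value `W₃₄ > 0` vs the empty-domain representation). [folklore] -/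
theorem hyperellipticRiemannRelation_false_without_domain₃₄ :
    ¬ (∀ (e : Fin 5 → ℚ), StrictMono e → ∀ (r₁₂ r₁₄ r₃₄ :
      Literature.NumberTheory.Transcendental.KZ.IntegralRep 2), r₁₂.domain = {x | (e 0 : ℝ) < x 0 ∧ x
      0 < (e 1 : ℝ) ∧ (e 1 : ℝ) < x 1 ∧ x 1 < (e 2 : ℝ)} → r₁₄.domain = {x | (e 0 : ℝ) < x 0 ∧ x 0 <
      (e 1 : ℝ) ∧ (e 3 : ℝ) < x 1 ∧ x 1 < (e 4 : ℝ)} → Set.EqOn r₁₂.integrand (fun x => (x 1 - x 0) /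
      Real.sqrt (|∏ i : Fin 5, (x 0 - (e i : ℝ))| * |∏ i : Fin 5, (x 1 - (e i : ℝ))|)) r₁₂.domain →
      Set.EqOn r₁₄.integrand (fun x => (x 1 - x 0) / Real.sqrt (|∏ i : Fin 5, (x 0 - (e i : ℝ))| * |∏
      i : Fin 5, (x 1 - (e i : ℝ))|)) r₁₄.domain → Set.EqOn r₃₄.integrand (fun x => (x 1 - x 0) /
      Real.sqrt (|∏ i : Fin 5, (x 0 - (e i : ℝ))| * |∏ i : Fin 5, (x 1 - (e i : ℝ))|)) r₃₄.domain →
      Literature.NumberTheory.Transcendental.KZ.of r₁₂ - Literature.NumberTheory.Transcendental.KZ.of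
      r₁₄ + Literature.NumberTheory.Transcendental.KZ.of r₃₄ ∈
      Literature.NumberTheory.Transcendental.KZ.relations) := by
  intro H
  obtain ⟨r₁₂, hd₁₂, hi₁₂⟩ := exists_rep₁₂
  obtain ⟨r₁₄, hd₁₄, hi₁₄⟩ := exists_rep₁₄
  obtain ⟨r₃₄, hd₃₄, hi₃₄⟩ := exists_rep₃₄
  obtain ⟨s, -, hsi, hsv⟩ := exists_emptyRep₂
  have h := H _ strictMono_e₀ r₁₂ r₁₄ r₃₄ (hd₁₂.trans box₁₂_e₀.symm) (hd₁₄.trans box₁₄_e₀.symm) (fun x _ => congrFun hi₁₂ x) (fun x _ => congrFun hi₁₄ x) (fun x _ => congrFun hi₃₄ x)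
  have h' := H _ strictMono_e₀ r₁₂ r₁₄ s (hd₁₂.trans box₁₂_e₀.symm) (hd₁₄.trans box₁₄_e₀.symm) (fun x _ => congrFun hi₁₂ x) (fun x _ => congrFun hi₁₄ x) (fun x _ => congrFun hsi x)
  exact not_both₃ (by rw [hsv]; exact (value_pos₃₄ strictMono_e₀ r₃₄ (hd₃₄.trans box₃₄_e₀.symm) (fun x _ => congrFun hi₃₄ x)).ne') h h'

/-- **Any proof must use the INTEGRAND hypothesis on `r₃₄`**: the crux with it deleted is false (witnesses: canonical vs the zero integrand on `(2,3)×(3,5)`). [folklore] -/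
theorem hyperellipticRiemannRelation_false_without_integrand₃₄ :
    ¬ (∀ (e : Fin 5 → ℚ), StrictMono e → ∀ (r₁₂ r₁₄ r₃₄ :
      Literature.NumberTheory.Transcendental.KZ.IntegralRep 2), r₁₂.domain = {x | (e 0 : ℝ) < x 0 ∧ x
      0 < (e 1 : ℝ) ∧ (e 1 : ℝ) < x 1 ∧ x 1 < (e 2 : ℝ)} → r₁₄.domain = {x | (e 0 : ℝ) < x 0 ∧ x 0 <
      (e 1 : ℝ) ∧ (e 3 : ℝ) < x 1 ∧ x 1 < (e 4 : ℝ)} → r₃₄.domain = {x | (e 2 : ℝ) < x 0 ∧ x 0 < (e 3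
      : ℝ) ∧ (e 3 : ℝ) < x 1 ∧ x 1 < (e 4 : ℝ)} → Set.EqOn r₁₂.integrand (fun x => (x 1 - x 0) /
      Real.sqrt (|∏ i : Fin 5, (x 0 - (e i : ℝ))| * |∏ i : Fin 5, (x 1 - (e i : ℝ))|)) r₁₂.domain →
      Set.EqOn r₁₄.integrand (fun x => (x 1 - x 0) / Real.sqrt (|∏ i : Fin 5, (x 0 - (e i : ℝ))| * |∏
      i : Fin 5, (x 1 - (e i : ℝ))|)) r₁₄.domain → Literature.NumberTheory.Transcendental.KZ.of r₁₂ -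
      Literature.NumberTheory.Transcendental.KZ.of r₁₄ + Literature.NumberTheory.Transcendental.KZ.of
      r₃₄ ∈ Literature.NumberTheory.Transcendental.KZ.relations) := by
  intro H
  obtain ⟨r₁₂, hd₁₂, hi₁₂⟩ := exists_rep₁₂
  obtain ⟨r₁₄, hd₁₄, hi₁₄⟩ := exists_rep₁₄
  obtain ⟨r₃₄, hd₃₄, hi₃₄⟩ := exists_rep₃₄
  have hσ : IsSemialgebraic ℚ {x : Fin 2 → ℝ | (2:ℝ) < x 0 ∧ x 0 < 3 ∧ (3:ℝ) < x 1 ∧ x 1 < 5} := by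
    simpa using isSemialgebraic_box 2 3 3 5
  obtain ⟨s, hsd, hsi, hsv⟩ := exists_zeroRep₂ hσ
  have h := H _ strictMono_e₀ r₁₂ r₁₄ r₃₄ (hd₁₂.trans box₁₂_e₀.symm) (hd₁₄.trans box₁₄_e₀.symm) (hd₃₄.trans box₃₄_e₀.symm) (fun x _ => congrFun hi₁₂ x) (fun x _ => congrFun hi₁₄ x)
  have h' := H _ strictMono_e₀ r₁₂ r₁₄ s (hd₁₂.trans box₁₂_e₀.symm) (hd₁₄.trans box₁₄_e₀.symm) (hsd.trans box₃₄_e₀.symm) (fun x _ => congrFun hi₁₂ x) (fun x _ => congrFun hi₁₄ x)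
  exact not_both₃ (by rw [hsv]; exact (value_pos₃₄ strictMono_e₀ r₃₄ (hd₃₄.trans box₃₄_e₀.symm) (fun x _ => congrFun hi₃₄ x)).ne') h h'

/-! ### §4 Rigidity of the sign pattern (tightness, given the crux)

Modulo an overall sign the eight patterns `(±,±,±)` on `([r₁₂],[r₁₄],[r₃₄])` fall into four
classes. `(+,+,+)` is never a relation (part 1, unconditionally). GIVEN the crux pattern
`(+,−,+)`, the two remaining mixed classes are not relations either: their differences with the
crux are `2[r₃₄]` (value `2W₃₄ > 0`) and `2[r₃₄] − 2[r₁₄]` (value `−2W₁₂ < 0`). So the coefficient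
vector `(1,−1,1)` is rigid: no proof can arrive at a re-signed variant. -/

/-- Given the crux for an admissible triple, the pattern `(+,−,−)` is not a relation.
[cite: KontsevichZagier2001, §1.2] -/
theorem pattern_pmm_not_mem_relations {e : Fin 5 → ℚ} (he : StrictMono e)
    (r₁₂ r₁₄ r₃₄ : KZ.IntegralRep 2)
    (_hd₁₂ : r₁₂.domain = {x | (e 0 : ℝ) < x 0 ∧ x 0 < (e 1 : ℝ) ∧ (e 1 : ℝ) < x 1 ∧ x 1 < (e 2 : ℝ)})
    (_hd₁₄ : r₁₄.domain = {x | (e 0 : ℝ) < x 0 ∧ x 0 < (e 1 : ℝ) ∧ (e 3 : ℝ) < x 1 ∧ x 1 < (e 4 : ℝ)})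
    (hd₃₄ : r₃₄.domain = {x | (e 2 : ℝ) < x 0 ∧ x 0 < (e 3 : ℝ) ∧ (e 3 : ℝ) < x 1 ∧ x 1 < (e 4 : ℝ)})
    (_hi₁₂ : EqOn r₁₂.integrand (fun x => (x 1 - x 0) /
      Real.sqrt (|∏ i : Fin 5, (x 0 - (e i : ℝ))| * |∏ i : Fin 5, (x 1 - (e i : ℝ))|)) r₁₂.domain)
    (_hi₁₄ : EqOn r₁₄.integrand (fun x => (x 1 - x 0) /
      Real.sqrt (|∏ i : Fin 5, (x 0 - (e i : ℝ))| * |∏ i : Fin 5, (x 1 - (e i : ℝ))|)) r₁₄.domain)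
    (hi₃₄ : EqOn r₃₄.integrand (fun x => (x 1 - x 0) /
      Real.sqrt (|∏ i : Fin 5, (x 0 - (e i : ℝ))| * |∏ i : Fin 5, (x 1 - (e i : ℝ))|)) r₃₄.domain)
    (h : KZ.of r₁₂ - KZ.of r₁₄ + KZ.of r₃₄ ∈ KZ.relations) :
    KZ.of r₁₂ - KZ.of r₁₄ - KZ.of r₃₄ ∉ KZ.relations := by
  intro h'
  have hd := KZ.relations.sub_mem h h'
  have : KZ.of r₁₂ - KZ.of r₁₄ + KZ.of r₃₄ - (KZ.of r₁₂ - KZ.of r₁₄ - KZ.of r₃₄) =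
      KZ.of r₃₄ + KZ.of r₃₄ := by abel
  rw [this] at hd
  exact add_not_mem_relations_of_value_pos (value_pos₃₄ he r₃₄ hd₃₄ hi₃₄)
    (value_pos₃₄ he r₃₄ hd₃₄ hi₃₄) hd

/-- Given the crux for an admissible triple, the pattern `(+,+,−)` is not a relation.
[cite: KontsevichZagier2001, §1.2] -/
theorem pattern_ppm_not_mem_relations {e : Fin 5 → ℚ} (he : StrictMono e)
    (r₁₂ r₁₄ r₃₄ : KZ.IntegralRep 2)
    (hd₁₂ : r₁₂.domain = {x | (e 0 : ℝ) < x 0 ∧ x 0 < (e 1 : ℝ) ∧ (e 1 : ℝ) < x 1 ∧ x 1 < (e 2 : ℝ)})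
    (_hd₁₄ : r₁₄.domain = {x | (e 0 : ℝ) < x 0 ∧ x 0 < (e 1 : ℝ) ∧ (e 3 : ℝ) < x 1 ∧ x 1 < (e 4 : ℝ)})
    (hd₃₄ : r₃₄.domain = {x | (e 2 : ℝ) < x 0 ∧ x 0 < (e 3 : ℝ) ∧ (e 3 : ℝ) < x 1 ∧ x 1 < (e 4 : ℝ)})
    (hi₁₂ : EqOn r₁₂.integrand (fun x => (x 1 - x 0) /
      Real.sqrt (|∏ i : Fin 5, (x 0 - (e i : ℝ))| * |∏ i : Fin 5, (x 1 - (e i : ℝ))|)) r₁₂.domain)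
    (_hi₁₄ : EqOn r₁₄.integrand (fun x => (x 1 - x 0) /
      Real.sqrt (|∏ i : Fin 5, (x 0 - (e i : ℝ))| * |∏ i : Fin 5, (x 1 - (e i : ℝ))|)) r₁₄.domain)
    (hi₃₄ : EqOn r₃₄.integrand (fun x => (x 1 - x 0) /
      Real.sqrt (|∏ i : Fin 5, (x 0 - (e i : ℝ))| * |∏ i : Fin 5, (x 1 - (e i : ℝ))|)) r₃₄.domain)
    (h : KZ.of r₁₂ - KZ.of r₁₄ + KZ.of r₃₄ ∈ KZ.relations) :
    KZ.of r₁₂ + KZ.of r₁₄ - KZ.of r₃₄ ∉ KZ.relations := by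
  intro h'
  have hd := KZ.relations.sub_mem h h'
  have hv := (AddMonoidHom.mem_ker).1 (KZ.relations_le_ker_eval_holds hd)
  simp only [map_add, map_sub, KZ.eval_of] at hv
  have h14 := value_eq_of_mem_relations h
  have h12 := value_pos₁₂ he r₁₂ hd₁₂ hi₁₂
  have h34 := value_pos₃₄ he r₃₄ hd₃₄ hi₃₄
  linarith

end Summit.KontsevichZagierPeriods.UnfoldedStokes.HyperellipticRiemannRelationNegative

end
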